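import Mathlib
import Literature.Computability.AlgebraicComplexity.RealTauKnownCases
import Summits.ValiantsHypothesis.ValiantsHypothesis.Theorems.LacunarySymmetroidMatrixDescartesStubDescartesCeiling

/-!
# `MatrixDescartes` (stmt-ValiantsHypothesis-18050) — the COMMON-DIRECTION LOW-RANK SECTOR, part 1:
# the factorisation `det (∑ₗ X^{dₗ}(cₗ • B + Wₗ)) = φ^(m − R) · h` and the monomial count of `h`

HONEST FRAMING.  Cell `pub-symmetroid`, seat `val-sym-mdr-p2` (gen 18); helper file `--supports` the crux
`Theses.LacunarySymmetroid.MatrixDescartes`, NO closure claim.  Linear-algebra kit consumed by the companion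
`…CommonDirection.lean` (the size-free ceiling `Z₊ + 1 ≤ (K − 1) + ∏(rank Wₗ + 1)·C(R + K − 1, K − 1)` and the
crux's inequality on the sector); nothing here bears on the crux in its window, `DoorA26`/`DoorA34`, or `VP ≠ VNP`.

THE SECTOR.  Letters `Sₗ = cₗ • B + Wₗ`: ONE common real `m × m` matrix `B` (any rank, no symmetry needed)
carried by an arbitrary `K`-nomial `φ = ∑ₗ C(cₗ) X^{dₗ}`, plus perturbations `Wₗ`; `R := ∑ₗ rank Wₗ`.  Every
letter may have full rank; the tree's low-rank sector (`…LowRankSector`) is the case `cₗ = 0` off one pivot.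

RESULTS (namespace `CommonDirection`; `g : Fin m → Option (Fin K)` ranges over ROW CHOICES, `none` = the
`B`-part, `N_g` = the real matrix whose `i`-th row is row `i` of `B` resp. of `W_{g i}`):
* `det_pencil_eq_sum` — row-multilinearity: `det F = ∑_g φ^{#g⁻¹(none)} X^{e(g)} C(det N_g)`, `e(g) = ∑ᵢ d(g i)`;
* `det_rowChoice_eq_zero` — if `g` uses `Wₗ` in more than `rank Wₗ` rows then `det N_g = 0`;
* `det_pencil_eq_mul` — **`det F = φ^(m − R) · h`**, `h = ∑_g φ^(#g⁻¹(none) − (m − R)) X^{e(g)} C(det N_g)`;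
* `det_scalar_pencil`, `card_support_phi_pow_le(')` — `det (∑ₗ X^{dₗ}(cₗ • 1_E)) = φ^E`, hence (tree
  `StubDescartesCeiling.card_support_det_pencil_le`, count vectors) `#supp(φ^E) ≤ C(E + K − 1, E) ≤ C(R + K − 1, K − 1)`
  for `E ≤ R`;
* `support_h_subset`, `card_support_h_le` — `supp h` lies in the union over count vectors `nₗ ≤ rank Wₗ` of the
  translates `supp(φ^((m − |n|) − (m − R))) + ∑ₗ nₗdₗ`, so **`#supp h ≤ ∏ₗ(rank Wₗ + 1) · C(R + K − 1, K − 1)`** —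
  independent of the size `m`;
* `card_posRoots_phi_pow_le` — the positive zeros of `φ^N ≠ 0` number at most `K − 1`.
Elementary (Mathlib + one tree lemma); axioms `propext`, `Classical.choice`, `Quot.sound`.  The helper objects are
written with file-local notation (no definitions are introduced).
-/

-- layout Summits/ValiantsHypothesis/ValiantsHypothesis forces the duplicated namespace component
set_option linter.dupNamespace false

namespace Summit.ValiantsHypothesis.ValiantsHypothesis.Theorems.LacunarySymmetroidMatrixDescartes

open Polynomial Finset
open scoped BigOperators Polynomial

namespace CommonDirection

/-- the scalar `K`-nomial `φ = ∑ₗ C(cₗ) X^{dₗ}` carrying the common direction -/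
local notation3 (prettyPrint := false) "φ[" d ", " c "]" =>
  (∑ l, Polynomial.C (c l) * (Polynomial.X : Polynomial ℝ) ^ (d l))

/-- the real matrix `N_g` of a row choice `g`: row `i` is row `i` of `B` (`g i = none`) or of `W_l` (`g i = some l`) -/
local notation3 (prettyPrint := false) "N[" B ", " W ", " g "]" =>
  (Matrix.of fun i j => Option.elim (g i) B W i j)

/-- number of rows in which the row choice `g` picks the piece `o` -/
local notation3 (prettyPrint := false) "cnt[" g ", " o "]" =>
  (Finset.univ.filter fun i => g i = o).card

/-- the cofactor `h` of the factorisation `det F = φ^(m − R) · h` (size `m` made explicit) -/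
local notation3 (prettyPrint := false) "hP[" m ", " d ", " B ", " c ", " W "]" =>
  (∑ g : Fin m → Option (Fin _),
    φ[d, c] ^ (cnt[g, none] - (m - ∑ l, (W l).rank)) * (Polynomial.X : Polynomial ℝ) ^ (∑ i, (g i).elim 0 d)
      * Polynomial.C (Matrix.det N[B, W, g]))

variable {K m : ℕ}

/-- Entries of the common-direction pencil: `(∑ₗ X^{dₗ} • (cₗ • B + Wₗ)) i j = φ · C(B i j) + ∑ₗ X^{dₗ} C(Wₗ i j)`.
[folklore] -/
theorem pencil_apply (d : Fin K → ℕ) (B : Matrix (Fin m) (Fin m) ℝ) (c : Fin K → ℝ)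
    (W : Fin K → Matrix (Fin m) (Fin m) ℝ) (i j : Fin m) :
    (∑ l, ((X : ℝ[X]) ^ d l) • (c l • B + W l).map C) i j
      = φ[d, c] * C (B i j) + ∑ l, X ^ d l * C (W l i j) := by
  simp only [Matrix.sum_apply, Matrix.smul_apply, Matrix.map_apply, Matrix.add_apply, smul_eq_mul,
    C_add, C_mul]
  rw [Finset.sum_mul, ← Finset.sum_add_distrib]
  refine Finset.sum_congr rfl fun l _ => ?_
  ring

/-- **Row decomposition**: as a family of rows the pencil is
`i ↦ ∑_o (φ^{[o = none]} X^{dₒ}) • (j ↦ C(N_o i j))` over `o : Option (Fin K)` (`d_none = 0`). [folklore] -/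
theorem pencil_eq_rows (d : Fin K → ℕ) (B : Matrix (Fin m) (Fin m) ℝ) (c : Fin K → ℝ)
    (W : Fin K → Matrix (Fin m) (Fin m) ℝ) :
    (∑ l, ((X : ℝ[X]) ^ d l) • (c l • B + W l).map C)
      = fun i => ∑ o : Option (Fin K),
          (φ[d, c] ^ (if o = none then 1 else 0) * X ^ (o.elim 0 d)) • (fun j => C (Option.elim o B W i j)) := by
  funext i j
  rw [pencil_apply]
  simp only [Finset.sum_apply, Pi.smul_apply, smul_eq_mul]
  rw [Fintype.sum_option]
  simp

/-- **Row-choice expansion** of the common-direction pencil determinant: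
`det F = ∑_g φ^{a(g)} X^{e(g)} C(det N_g)`, `a(g) = ∑ᵢ [g i = none]`, `e(g) = ∑ᵢ d(g i)` (`d none = 0`). [folklore] -/
theorem det_pencil_eq_sum (d : Fin K → ℕ) (B : Matrix (Fin m) (Fin m) ℝ) (c : Fin K → ℝ)
    (W : Fin K → Matrix (Fin m) (Fin m) ℝ) :
    Matrix.det (∑ l, ((X : ℝ[X]) ^ d l) • (c l • B + W l).map C) =
      ∑ g : Fin m → Option (Fin K),
        φ[d, c] ^ (∑ i, (if g i = none then 1 else 0)) * X ^ (∑ i, (g i).elim 0 d)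
          * C (Matrix.det N[B, W, g]) := by
  rw [pencil_eq_rows]
  have h1 : Matrix.det ((fun i => ∑ o : Option (Fin K),
          (φ[d, c] ^ (if o = none then 1 else 0) * X ^ (o.elim 0 d)) • (fun j => C (Option.elim o B W i j)))
        : Matrix (Fin m) (Fin m) ℝ[X])
      = (Matrix.detRowAlternating : ((Fin m → ℝ[X]) [⋀^Fin m]→ₗ[ℝ[X]] ℝ[X])).toMultilinearMap
          (fun i => ∑ o : Option (Fin K),
            (φ[d, c] ^ (if o = none then 1 else 0) * X ^ (o.elim 0 d)) •
              (fun j => C (Option.elim o B W i j))) := rfl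
  rw [h1, MultilinearMap.map_sum
        ((Matrix.detRowAlternating : ((Fin m → ℝ[X]) [⋀^Fin m]→ₗ[ℝ[X]] ℝ[X])).toMultilinearMap)
        (fun i o => (φ[d, c] ^ (if o = none then 1 else 0) * X ^ (o.elim 0 d)) •
          (fun j => C (Option.elim o B W i j)))]
  refine Finset.sum_congr rfl fun g _ => ?_
  rw [MultilinearMap.map_smul_univ, smul_eq_mul]
  have hprod : ∏ i, (φ[d, c] ^ (if g i = none then 1 else 0) * X ^ ((g i).elim 0 d))
      = φ[d, c] ^ (∑ i, (if g i = none then 1 else 0)) * X ^ (∑ i, (g i).elim 0 d) := by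
    rw [Finset.prod_mul_distrib, Finset.prod_pow_eq_pow_sum, Finset.prod_pow_eq_pow_sum]
  rw [hprod]
  congr 1
  rw [RingHom.map_det]
  rfl

/-- **Rank kills over-used perturbations**: if `g` chooses `Wₗ` in more than `rank Wₗ` rows then
`det N_g = 0`. [folklore] -/
theorem det_rowChoice_eq_zero (B : Matrix (Fin m) (Fin m) ℝ) (W : Fin K → Matrix (Fin m) (Fin m) ℝ)
    (g : Fin m → Option (Fin K)) (l : Fin K) (h : (W l).rank < cnt[g, some l]) :
    Matrix.det N[B, W, g] = 0 := by
  apply Matrix.det_eq_zero_of_not_linearIndependent_rows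
  intro hli
  have hsub : LinearIndependent ℝ (fun i : {i // g i = some l} => N[B, W, g] i.1) :=
    hli.comp _ Subtype.val_injective
  have heq : (fun i : {i // g i = some l} => N[B, W, g] i.1)
      = fun i : {i // g i = some l} => (W l).row i.1 := by
    funext i
    ext j
    simp [Matrix.row, i.2]
  rw [heq] at hsub
  have hcard := finrank_span_eq_card hsub
  have hle : Module.finrank ℝ (Submodule.span ℝ (Set.range fun i : {i // g i = some l} => (W l).row i.1))
      ≤ (W l).rank := by
    rw [Matrix.rank_eq_finrank_span_row]
    exact Submodule.finrank_mono (Submodule.span_mono (by rintro _ ⟨i, rfl⟩; exact ⟨i.1, rfl⟩))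
  rw [hcard, Fintype.card_subtype] at hle
  omega

/-- The row counts of `g` over `Option (Fin K)` add up to `m`: `a(g) + ∑ₗ nₗ(g) = m`. [folklore] -/
theorem cnt_none_add_sum (g : Fin m → Option (Fin K)) : cnt[g, none] + ∑ l, cnt[g, some l] = m := by
  have h := Finset.card_eq_sum_card_fiberwise (f := g) (s := univ) (t := univ) (fun _ _ => by simp)
  rw [Finset.card_fin, Fintype.sum_option] at h
  exact h.symm

/-- `∑ᵢ [g i = none] = a(g)`, the number of rows choosing the `B`-part. [folklore] -/
theorem sum_ind_eq (g : Fin m → Option (Fin K)) : ∑ i, (if g i = none then 1 else 0) = cnt[g, none] := by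
  rw [Finset.card_filter]

/-- `∑ᵢ d(g i) = ∑ₗ nₗ(g) · dₗ` (with `d none = 0`). [folklore] -/
theorem sum_ex_eq (d : Fin K → ℕ) (g : Fin m → Option (Fin K)) :
    ∑ i, (g i).elim 0 d = ∑ l, cnt[g, some l] * d l := by
  rw [show (∑ i, (g i).elim 0 d) = ∑ i, (fun o : Option (Fin K) => o.elim 0 d) (g i) from rfl,
    ← Finset.sum_fiberwise' univ g (fun o : Option (Fin K) => o.elim 0 d), Fintype.sum_option]
  simp only [Option.elim_none, Option.elim_some, Finset.sum_const_zero, zero_add, Finset.sum_const,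
    smul_eq_mul]

/-- A surviving row choice (`det N_g ≠ 0`) uses each `Wₗ` at most `rank Wₗ` times. [folklore] -/
theorem cnt_le_rank_of_ne_zero (B : Matrix (Fin m) (Fin m) ℝ) (W : Fin K → Matrix (Fin m) (Fin m) ℝ)
    (g : Fin m → Option (Fin K)) (h : Matrix.det N[B, W, g] ≠ 0) (l : Fin K) :
    cnt[g, some l] ≤ (W l).rank := by
  by_contra hlt
  exact h (det_rowChoice_eq_zero B W g l (not_le.1 hlt))

/-- **FACTORISATION** `det (∑ₗ X^{dₗ}(cₗ • B + Wₗ)) = φ^(m − R) · h`, `R = ∑ₗ rank Wₗ`,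
`h = ∑_g φ^(a(g) − (m − R)) X^{e(g)} C(det N_g)`. [folklore] -/
theorem det_pencil_eq_mul (d : Fin K → ℕ) (B : Matrix (Fin m) (Fin m) ℝ) (c : Fin K → ℝ)
    (W : Fin K → Matrix (Fin m) (Fin m) ℝ) :
    Matrix.det (∑ l, ((X : ℝ[X]) ^ d l) • (c l • B + W l).map C) =
      φ[d, c] ^ (m - ∑ l, (W l).rank) * hP[m, d, B, c, W] := by
  rw [det_pencil_eq_sum, Finset.mul_sum]
  refine Finset.sum_congr rfl fun g _ => ?_
  rw [sum_ind_eq]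
  by_cases hz : Matrix.det N[B, W, g] = 0
  · rw [hz, map_zero, mul_zero, mul_zero, mul_zero]
  · have hcnt : m - ∑ l, (W l).rank ≤ cnt[g, none] := by
      have h1 := cnt_none_add_sum g
      have h2 : ∑ l, cnt[g, some l] ≤ ∑ l, (W l).rank :=
        Finset.sum_le_sum fun l _ => cnt_le_rank_of_ne_zero B W g hz l
      omega
    rw [← mul_assoc, ← mul_assoc, ← pow_add, Nat.add_sub_cancel' hcnt]

/-- The scalar pencil `∑ₗ X^{dₗ} • (cₗ • 1_E)` has determinant `φ^E`. [folklore] -/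
theorem det_scalar_pencil (d : Fin K → ℕ) (c : Fin K → ℝ) (E : ℕ) :
    Matrix.det (∑ l, ((X : ℝ[X]) ^ d l) • (c l • (1 : Matrix (Fin E) (Fin E) ℝ)).map C)
      = φ[d, c] ^ E := by
  have hmat : (∑ l, ((X : ℝ[X]) ^ d l) • (c l • (1 : Matrix (Fin E) (Fin E) ℝ)).map C)
      = φ[d, c] • (1 : Matrix (Fin E) (Fin E) ℝ[X]) := by
    funext i j
    simp only [Matrix.sum_apply, Matrix.smul_apply, Matrix.map_apply, Matrix.one_apply, smul_eq_mul]
    by_cases hij : i = j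
    · simp only [if_pos hij, mul_one]
      exact Finset.sum_congr rfl fun l _ => by rw [mul_comm]
    · simp only [if_neg hij, mul_zero, map_zero, Finset.sum_const_zero]
  rw [hmat, Matrix.det_smul, Matrix.det_one, mul_one, Fintype.card_fin]

/-- Monomial count of a power of the `K`-nomial `φ`: `#supp(φ^E) ≤ C(E + K − 1, E)` (count vectors, via the
tree's `StubDescartesCeiling.card_support_det_pencil_le` for the scalar pencil). [folklore] -/
theorem card_support_phi_pow_le (d : Fin K → ℕ) (c : Fin K → ℝ) (E : ℕ) :
    (φ[d, c] ^ E).support.card ≤ Nat.choose (E + K - 1) E := by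
  rw [← det_scalar_pencil d c E]
  exact StubDescartesCeiling.card_support_det_pencil_le d (fun l => c l • (1 : Matrix (Fin E) (Fin E) ℝ))

/-- Monotone form of the monomial count: for `E ≤ R` and `K ≥ 1`, `#supp(φ^E) ≤ C(R + K − 1, K − 1)`.
[folklore] -/
theorem card_support_phi_pow_le' (hK : 0 < K) (d : Fin K → ℕ) (c : Fin K → ℝ) {E R : ℕ}
    (hE : E ≤ R) : (φ[d, c] ^ E).support.card ≤ Nat.choose (R + K - 1) (K - 1) := by
  obtain ⟨K', rfl⟩ : ∃ K', K = K' + 1 := ⟨K - 1, by omega⟩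
  refine (card_support_phi_pow_le d c E).trans ?_
  have e1 : E + (K' + 1) - 1 = E + K' := by omega
  have e2 : R + (K' + 1) - 1 = R + K' := by omega
  rw [e1, e2, Nat.add_sub_cancel, Nat.choose_symm_add]
  exact Nat.choose_le_choose K' (by omega)

/-- **Support of `h`**: it lies in the union, over count vectors `nₗ ≤ rank Wₗ`, of the translates
`supp(φ^((m − |n|) − (m − R))) + ∑ₗ nₗ dₗ`. [folklore] -/
theorem support_h_subset (d : Fin K → ℕ) (B : Matrix (Fin m) (Fin m) ℝ) (c : Fin K → ℝ)
    (W : Fin K → Matrix (Fin m) (Fin m) ℝ) :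
    (hP[m, d, B, c, W]).support ⊆
      (Fintype.piFinset fun l => Finset.range ((W l).rank + 1)).biUnion
        (fun n : Fin K → ℕ =>
          ((φ[d, c]) ^ ((m - ∑ l, n l) - (m - ∑ l, (W l).rank))).support.image
            (fun k => k + ∑ l, n l * d l)) := by
  intro k hk
  rw [mem_support_iff, finsetSum_coeff] at hk
  obtain ⟨g, -, hg⟩ := Finset.exists_ne_zero_of_sum_ne_zero hk
  rw [coeff_mul_C, coeff_mul_X_pow'] at hg
  have hdet : Matrix.det N[B, W, g] ≠ 0 := by
    intro h0
    exact hg (by rw [h0, mul_zero])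
  have hle : (∑ i, (g i).elim 0 d) ≤ k := by
    by_contra hlt
    exact hg (by rw [if_neg hlt, zero_mul])
  rw [if_pos hle] at hg
  have hcoeff : (φ[d, c] ^ (cnt[g, none] - (m - ∑ l, (W l).rank))).coeff (k - ∑ i, (g i).elim 0 d) ≠ 0 :=
    fun h0 => hg (by rw [h0, zero_mul])
  refine Finset.mem_biUnion.2 ⟨fun l => cnt[g, some l], ?_, ?_⟩
  · refine Fintype.mem_piFinset.2 fun l => Finset.mem_range.2 ?_
    exact Nat.lt_succ_of_le (cnt_le_rank_of_ne_zero B W g hdet l)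
  · refine Finset.mem_image.2 ⟨k - ∑ i, (g i).elim 0 d, ?_, ?_⟩
    · rw [mem_support_iff]
      have hm : m - ∑ l, cnt[g, some l] = cnt[g, none] := by
        have := cnt_none_add_sum g
        omega
      rw [hm]
      exact hcoeff
    · rw [← sum_ex_eq d g]
      omega

/-- **Monomial count of `h`**: `#supp h ≤ (∏ₗ (rank Wₗ + 1)) · C(R + K − 1, K − 1)` — independent of the size
`m`. [folklore] -/
theorem card_support_h_le (hK : 0 < K) (d : Fin K → ℕ) (B : Matrix (Fin m) (Fin m) ℝ)
    (c : Fin K → ℝ) (W : Fin K → Matrix (Fin m) (Fin m) ℝ) :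
    (hP[m, d, B, c, W]).support.card ≤
      (∏ l, ((W l).rank + 1)) * Nat.choose ((∑ l, (W l).rank) + K - 1) (K - 1) := by
  calc (hP[m, d, B, c, W]).support.card
      ≤ ((Fintype.piFinset fun l => Finset.range ((W l).rank + 1)).biUnion
          (fun n : Fin K → ℕ =>
            ((φ[d, c]) ^ ((m - ∑ l, n l) - (m - ∑ l, (W l).rank))).support.image
              (fun k => k + ∑ l, n l * d l))).card := Finset.card_le_card (support_h_subset d B c W)
    _ ≤ ∑ n ∈ (Fintype.piFinset fun l => Finset.range ((W l).rank + 1)),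
          (((φ[d, c]) ^ ((m - ∑ l, n l) - (m - ∑ l, (W l).rank))).support.image
              (fun k => k + ∑ l, n l * d l)).card := Finset.card_biUnion_le
    _ ≤ ∑ _n ∈ (Fintype.piFinset fun l => Finset.range ((W l).rank + 1)),
          Nat.choose ((∑ l, (W l).rank) + K - 1) (K - 1) := by
          refine Finset.sum_le_sum fun n _ => ?_
          refine Finset.card_image_le.trans ?_
          exact card_support_phi_pow_le' hK d c (by omega)
    _ = (∏ l, ((W l).rank + 1)) * Nat.choose ((∑ l, (W l).rank) + K - 1) (K - 1) := by
          rw [Finset.sum_const, smul_eq_mul, Fintype.card_piFinset]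
          simp only [Finset.card_range]

/-- The positive zeros of `φ^N` number at most `K − 1` as soon as `φ^N ≠ 0` and `K ≥ 1` (sparse Descartes rule
for the `K`-nomial `φ`). [folklore] -/
theorem card_posRoots_phi_pow_le (hK : 0 < K) (d : Fin K → ℕ) (c : Fin K → ℝ) (N : ℕ)
    (hφ : φ[d, c] ^ N ≠ 0) :
    ((φ[d, c] ^ N).roots.toFinset.filter (fun t => 0 < t)).card ≤ K - 1 := by
  rcases Nat.eq_zero_or_pos N with hN | hN
  · subst hN
    simp
  · have hφ0 : φ[d, c] ≠ 0 := fun h0 => hφ (by rw [h0, zero_pow (Nat.pos_iff_ne_zero.1 hN)])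
    rw [Polynomial.roots_pow, Multiset.toFinset_nsmul _ _ (Nat.pos_iff_ne_zero.1 hN)]
    have h1 :=
      Literature.Computability.AlgebraicComplexity.card_roots_toFinset_filter_pos_lt_card_support hφ0
    have h2 : (φ[d, c]).support.card ≤ K := by
      have h3 := card_support_phi_pow_le d c 1
      rw [pow_one] at h3
      refine h3.trans ?_
      obtain ⟨K', rfl⟩ : ∃ K', K = K' + 1 := ⟨K - 1, by omega⟩
      have e1 : 1 + (K' + 1) - 1 = K' + 1 := by omega
      rw [e1, Nat.choose_one_right]
    omega

end CommonDirection

end Summit.ValiantsHypothesis.ValiantsHypothesis.Theorems.LacunarySymmetroidMatrixDescartes
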